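import Summits.FinalStateConjecture.FinalStateConjecture.Theorems.StarvedNecksNecksCertifyStubSeamSurgeryCover
import Summits.FinalStateConjecture.FinalStateConjecture.Theorems.StarvedNecksNecksCertifyStubSeamSurgeryExterior
import Summits.FinalStateConjecture.FinalStateConjecture.Theorems.StarvedNecksNecksCertifyStubSeamSurgeryClosure

/-!
# Route StarvedNecks — crux `NecksCertify`, line `two-cap-focusing-ledger`: seam surgery, multi-hole clauses of `d₂`

Helper file for the registered stub `stub_seamSurgery` (N2): the clauses of the seamed decomposition
that involve all holes at once, stated directly for the components of the new decomposition
(abstract re-clocked backgrounds `B₂ j`, new charts `Gl j ∘ inclusion`, shrunk flat domain `U₂`):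

* `pairwiseDisjoint₂` — structure field `exists_pairwise_disjoint` (A11 + A9);
* `covering₂` — structure field `diff_subset_causalPast` (`covering_clause` of `…Cover`);
* `reach₂` — every point of `O` is causally below the late charted region of the new decomposition
  (`reach_charted` of `…Exterior`), for `O = exteriorOf 𝒟 d₂.charted`;
* `seamed₂_eleven` — `Seamed` S11 (`flat_closure` of `…Closure`);
* `stub_seamSurgery_finMax` (registered helper sub-goal, anchor).

Mathlib + the landed seam helper modules; no definitions, no named facts.
-/

noncomputable section

open scoped Manifold ContDiff Topology ENNReal
open Filter Set Function Topology Literature.Geometry.Lorentzian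

namespace Summit.FinalStateConjecture.FinalStateConjecture.Theorems.NecksCertifyTwoCap.Seam

set_option linter.dupNamespace false

/-- Registered helper sub-goal `stub_seamSurgery_finMax` of N2 (anchor of this file): finitely many
real thresholds have a common upper bound. [folklore] -/
theorem stub_seamSurgery_finMax : ∀ (N : ℕ) (τ : Fin N → ℝ), ∃ T : ℝ, ∀ j, τ j ≤ T :=
  fun _ τ ↦ Finite.exists_le τ

variable {𝓢 : Spacetime.{0} 4}

/-- Structure field `exists_pairwise_disjoint` of the seamed decomposition: beyond a common time the
truncated late regions `{t₂ > τ₂, r ≤ R'}` lie inside the shells (A9), where the new charts are the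
re-gauged charts `Ψ'`, whose tube images are pairwise disjoint (A11). [folklore] -/
theorem pairwiseDisjoint₂ {N : ℕ} (Λ : Fin N → lorentzGroup) (c : Fin N → E4) (M a : Fin N → ℝ)
    (τ₁ T : ℝ) (s : Fin N → ℝ) (hs : ∀ j, 0 ≤ s j) (hT : τ₁ + 3 ≤ T)
    (Rg : Fin N → ℝ → ℝ)
    (hA9 : ∀ j, Tendsto (Rg j) atTop atTop)
    (b : Fin N → ℝ → ℝ)
    (hbRg : ∀ j t, Rg j t + 21 / 20 ≤ b j t)
    (Ψ' Gl : ∀ j, (boostedKerrBackground (Λ j) (c j) (M j) (a j)).domain → 𝓢.carrier)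
    (hGl2 : ∀ j (x : (boostedKerrBackground (Λ j) (c j) (M j) (a j)).domain), τ₁ + 2 + s j ≤ (boostedKerrBackground (Λ j) (c j) (M j) (a j)).time x → (boostedKerrBackground (Λ j) (c j) (M j) (a j)).radius x < b j ((boostedKerrBackground (Λ j) (c j) (M j) (a j)).time x) →
      Gl j x = Ψ' j x)
    (hA11 : ∀ i j, i ≠ j → Disjoint (Ψ' i '' {x | τ₁ < (boostedKerrBackground (Λ i) (c i) (M i) (a i)).time x ∧
      (boostedKerrBackground (Λ i) (c i) (M i) (a i)).radius x <
        Rg i ((boostedKerrBackground (Λ i) (c i) (M i) (a i)).time x) + 2})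
      (Ψ' j '' {x | τ₁ < (boostedKerrBackground (Λ j) (c j) (M j) (a j)).time x ∧ (boostedKerrBackground (Λ j) (c j) (M j) (a j)).radius x < Rg j ((boostedKerrBackground (Λ j) (c j) (M j) (a j)).time x) + 2}))
    (B₂ : Fin N → ModelBackground) (hle : ∀ j, (B₂ j).domain ≤ (boostedKerrBackground (Λ j) (c j) (M j) (a j)).domain)
    (htime : ∀ j y, (B₂ j).time y = (boostedKerrBackground (Λ j) (c j) (M j) (a j)).time y - s j)
    (hrad : ∀ j y, (B₂ j).radius y = (boostedKerrBackground (Λ j) (c j) (M j) (a j)).radius y) :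
    ∀ R' : ℝ, ∃ τ₂ : ℝ, Pairwise (Function.onFun Disjoint fun i ↦ (Gl i ∘ TopologicalSpace.Opens.inclusion (hle i)) '' (B₂ i).truncLateRegion τ₂ R') := by
  intro R'
  have hev : ∀ i, ∃ τi : ℝ, ∀ t, τi ≤ t → R' ≤ Rg i t := fun i ↦ by
    obtain ⟨τi, hτi⟩ := eventually_atTop.1 ((hA9 i).eventually (eventually_ge_atTop R'))
    exact ⟨τi, hτi⟩
  choose τi hτi using hev
  obtain ⟨τm, hτm⟩ := Finite.exists_le τi
  refine ⟨max T τm, fun i j hij ↦ ?_⟩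
  have himg : ∀ j, (Gl j ∘ TopologicalSpace.Opens.inclusion (hle j)) '' (B₂ j).truncLateRegion (max T τm) R' ⊆
      Ψ' j '' {x | τ₁ < (boostedKerrBackground (Λ j) (c j) (M j) (a j)).time x ∧ (boostedKerrBackground (Λ j) (c j) (M j) (a j)).radius x < Rg j ((boostedKerrBackground (Λ j) (c j) (M j) (a j)).time x) + 2} := by
    intro j
    rintro _ ⟨x, ⟨hxt, hxr⟩, rfl⟩
    have hxt' : max T τm < (B₂ j).time x.1 := hxt
    have hxr' : (B₂ j).radius x.1 ≤ R' := hxr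
    rw [htime] at hxt'
    rw [hrad] at hxr'
    have ht2 : τi j ≤ (boostedKerrBackground (Λ j) (c j) (M j) (a j)).time x.1 := by linarith [le_max_right T τm, hτm j, hs j]
    have hR := hτi j _ ht2
    refine ⟨TopologicalSpace.Opens.inclusion (hle j) x,
      ⟨by show τ₁ < (boostedKerrBackground (Λ j) (c j) (M j) (a j)).time x.1; linarith [hs j, le_max_left T τm],
      by show (boostedKerrBackground (Λ j) (c j) (M j) (a j)).radius x.1 < _; linarith⟩, ?_⟩
    exact (hGl2 j _ (by show _ ≤ (boostedKerrBackground (Λ j) (c j) (M j) (a j)).time x.1; linarith [hs j, le_max_left T τm])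
      (by show (boostedKerrBackground (Λ j) (c j) (M j) (a j)).radius x.1 < b j ((boostedKerrBackground (Λ j) (c j) (M j) (a j)).time x.1); linarith [hbRg j ((boostedKerrBackground (Λ j) (c j) (M j) (a j)).time x.1)])).symm
  exact (hA11 i j hij).mono (himg i) (himg j)

/-- Structure field `diff_subset_causalPast` of the seamed decomposition (`covering_clause` in the
vocabulary of the new decomposition).  O'Neill 1983, Ch. 14, pp. 402–403. [folklore] -/
theorem covering₂ {N : ℕ} (Λ : Fin N → lorentzGroup) (c : Fin N → E4) (M a : Fin N → ℝ) (R₁ τ₁ τf T : ℝ) (s : Fin N → ℝ)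
    (hs : ∀ j, 0 ≤ s j)
    (hτ : τf ≤ τ₁)
    (hT : τ₁ + 3 ≤ T)
    (hdomeq : ∀ j (y y' : E4), (boostedKerrBackground (Λ j) (c j) (M j) (a j)).radius y' = (boostedKerrBackground (Λ j) (c j) (M j) (a j)).radius y → y ∈ (boostedKerrBackground (Λ j) (c j) (M j) (a j)).domain → y' ∈ (boostedKerrBackground (Λ j) (c j) (M j) (a j)).domain)
    (Rg : Fin N → ℝ → ℝ)
    (hRgm : ∀ j, Monotone (Rg j))
    (hRgc : ∀ j, Continuous (Rg j))
    (hRg4 : ∀ j t, R₁ + 4 ≤ Rg j t)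
    (b : Fin N → ℝ → ℝ)
    (hbm : ∀ j, Monotone (b j))
    (hbRg : ∀ j t, Rg j t + 21 / 20 ≤ b j t ∧ b j t ≤ Rg j t + 29 / 20)
    (Ψ Ψ' Gl : ∀ j, (boostedKerrBackground (Λ j) (c j) (M j) (a j)).domain → 𝓢.carrier)
    (hA1a : ∀ j, ContMDiffOn 𝓘(ℝ, E4) (𝓡 4) ∞ (Ψ' j)
      {x | τ₁ < (boostedKerrBackground (Λ j) (c j) (M j) (a j)).time x ∧ (boostedKerrBackground (Λ j) (c j) (M j) (a j)).radius x < Rg j ((boostedKerrBackground (Λ j) (c j) (M j) (a j)).time x) + 2})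
    (hA2 : ∀ j (x : (boostedKerrBackground (Λ j) (c j) (M j) (a j)).domain), (boostedKerrBackground (Λ j) (c j) (M j) (a j)).radius x ≤ R₁ + 1 → Ψ' j x = Ψ j x)
    (hA8 : ∀ j (x : (boostedKerrBackground (Λ j) (c j) (M j) (a j)).domain), τ₁ ≤ (boostedKerrBackground (Λ j) (c j) (M j) (a j)).time x → R₁ ≤ (boostedKerrBackground (Λ j) (c j) (M j) (a j)).radius x →
      (boostedKerrBackground (Λ j) (c j) (M j) (a j)).radius x ≤ Rg j ((boostedKerrBackground (Λ j) (c j) (M j) (a j)).time x) + 2 →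
      𝓢.timeOrientation.IsFutureDirected
        (mfderiv 𝓘(ℝ, E4) (𝓡 4) (Ψ' j) x ((Λ j : E4 ≃L[ℝ] E4) (E4.basisVector 0))))
    (hHc2 : ∀ j (ϱ τ₂ : ℝ), R₁ ≤ ϱ → τf < τ₂ →
      Ψ j '' {x | τf < (boostedKerrBackground (Λ j) (c j) (M j) (a j)).time x ∧ (boostedKerrBackground (Λ j) (c j) (M j) (a j)).time x < τ₂ ∧ (boostedKerrBackground (Λ j) (c j) (M j) (a j)).radius x < ϱ} ⊆
        𝓢.metric.causalPast 𝓢.timeOrientation (Ψ j '' (boostedKerrBackground (Λ j) (c j) (M j) (a j)).truncTimeSlab ϱ τ₂))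
    (W₀ : TopologicalSpace.Opens E4) (Φ : W₀ → 𝓢.carrier) (P : E4 → Prop)
    (hA3 : ∀ j (y : E4) (hy : y ∈ (boostedKerrBackground (Λ j) (c j) (M j) (a j)).domain), τ₁ ≤ y 0 → P y →
      (boostedKerrBackground (Λ j) (c j) (M j) (a j)).radius y ≤ Rg j ((boostedKerrBackground (Λ j) (c j) (M j) (a j)).time y) + 2 → ∃ hw : y ∈ W₀, Ψ' j ⟨y, hy⟩ = Φ ⟨y, hw⟩)
    (hcollar : ∀ j (y : E4), y ∈ (boostedKerrBackground (Λ j) (c j) (M j) (a j)).domain → τ₁ + 1 + s j < (boostedKerrBackground (Λ j) (c j) (M j) (a j)).time y →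
      Rg j ((boostedKerrBackground (Λ j) (c j) (M j) (a j)).time y) + 17 / 20 < (boostedKerrBackground (Λ j) (c j) (M j) (a j)).radius y → (boostedKerrBackground (Λ j) (c j) (M j) (a j)).radius y < Rg j ((boostedKerrBackground (Λ j) (c j) (M j) (a j)).time y) + 2 →
      τ₁ ≤ y 0 ∧ τf < y 0 ∧ P y)
    (hGl2 : ∀ j (x : (boostedKerrBackground (Λ j) (c j) (M j) (a j)).domain), τ₁ + 2 + s j ≤ (boostedKerrBackground (Λ j) (c j) (M j) (a j)).time x → (boostedKerrBackground (Λ j) (c j) (M j) (a j)).radius x < b j ((boostedKerrBackground (Λ j) (c j) (M j) (a j)).time x) →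
      Gl j x = Ψ' j x)
    (horth : ∀ j, 0 < ((Λ j : E4 ≃L[ℝ] E4) (E4.basisVector 0)) 0)
    (hlag : ∀ j (y : E4), τ₁ ≤ (boostedKerrBackground (Λ j) (c j) (M j) (a j)).time y → (boostedKerrBackground (Λ j) (c j) (M j) (a j)).radius y ≤ Rg j ((boostedKerrBackground (Λ j) (c j) (M j) (a j)).time y) + 2 → (boostedKerrBackground (Λ j) (c j) (M j) (a j)).time y - s j ≤ y 0)
    (htube : ∀ j (y : E4), y ∈ (boostedKerrBackground (Λ j) (c j) (M j) (a j)).domain → τ₁ ≤ y 0 → (boostedKerrBackground (Λ j) (c j) (M j) (a j)).radius y ≤ Rg j ((boostedKerrBackground (Λ j) (c j) (M j) (a j)).time y) + 2 → ¬ P y →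
      (boostedKerrBackground (Λ j) (c j) (M j) (a j)).radius y + 3 ≤ Rg j ((boostedKerrBackground (Λ j) (c j) (M j) (a j)).time y))
    (hY : ∀ j (y : E4), T < y 0 → (boostedKerrBackground (Λ j) (c j) (M j) (a j)).radius y ≤ Rg j ((boostedKerrBackground (Λ j) (c j) (M j) (a j)).time y) + 2 → τ₁ + 3 ≤ (boostedKerrBackground (Λ j) (c j) (M j) (a j)).time y - s j)
    (O : Set 𝓢.carrier)
    (hA13 : O \ (Φ '' {y : W₀ | T < y.1 0 ∧ P y.1} ∪
        ⋃ j, Ψ' j '' {x | τ₁ + 5 / 2 + s j < (boostedKerrBackground (Λ j) (c j) (M j) (a j)).time x ∧ (boostedKerrBackground (Λ j) (c j) (M j) (a j)).radius x < Rg j ((boostedKerrBackground (Λ j) (c j) (M j) (a j)).time x) + 2}) ⊆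
      𝓢.metric.causalPast 𝓢.timeOrientation (Φ '' {y : W₀ | y.1 0 = T ∧ P y.1} ∪
        ⋃ j, Ψ' j '' {x | (boostedKerrBackground (Λ j) (c j) (M j) (a j)).time x = τ₁ + 5 / 2 + s j ∧ (boostedKerrBackground (Λ j) (c j) (M j) (a j)).radius x < Rg j ((boostedKerrBackground (Λ j) (c j) (M j) (a j)).time x) + 2}))
    (B₂ : Fin N → ModelBackground) (hle : ∀ j, (B₂ j).domain ≤ (boostedKerrBackground (Λ j) (c j) (M j) (a j)).domain)
    (hset : ∀ j, ((boostedKerrBackground (Λ j) (c j) (M j) (a j)).domain : Set E4) ⊆ (B₂ j).domain)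
    (htime : ∀ j y, (B₂ j).time y = (boostedKerrBackground (Λ j) (c j) (M j) (a j)).time y - s j)
    (U₂ : TopologicalSpace.Opens E4) (hU₂le : U₂ ≤ W₀) (hUmk : ∀ y : E4, T - 1 < y 0 → P y → y ∈ U₂) :
    O \ ((⋃ i, (Gl i ∘ TopologicalSpace.Opens.inclusion (hle i)) '' (B₂ i).lateRegion T) ∪ (Φ ∘ TopologicalSpace.Opens.inclusion hU₂le) '' (Minkowski.backgroundOn U₂).lateRegion T) ⊆
      𝓢.metric.causalPast 𝓢.timeOrientation
        ((⋃ i, (Gl i ∘ TopologicalSpace.Opens.inclusion (hle i)) '' (B₂ i).timeSlab T) ∪ (Φ ∘ TopologicalSpace.Opens.inclusion hU₂le) '' (Minkowski.backgroundOn U₂).timeSlab T) := by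
  have hcov := covering_clause N Λ c M a R₁ τ₁ τf T s hs hτ hT hdomeq Rg hRgm hRgc hRg4 b hbm hbRg Ψ Ψ' Gl
    hA1a hA2 hA8 hHc2 W₀ Φ P hA3 hcollar hGl2 horth hlag htube hY O hA13
  have hconvL : (⋃ j, Gl j '' {x | T + s j < (boostedKerrBackground (Λ j) (c j) (M j) (a j)).time x}) ∪ Φ '' {y : W₀ | T < y.1 0 ∧ P y.1} ⊆
      (⋃ i, (Gl i ∘ TopologicalSpace.Opens.inclusion (hle i)) '' (B₂ i).lateRegion T) ∪ (Φ ∘ TopologicalSpace.Opens.inclusion hU₂le) '' (Minkowski.backgroundOn U₂).lateRegion T := by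
    rintro q (hq | ⟨y, ⟨hy1, hy2⟩, rfl⟩)
    · obtain ⟨j, x, hx, rfl⟩ := mem_iUnion.mp hq |>.imp fun j h ↦ h
      have hx' : T + s j < (boostedKerrBackground (Λ j) (c j) (M j) (a j)).time x.1 := hx
      refine Or.inl (mem_iUnion.mpr ⟨j, ⟨x.1, hset j x.2⟩, ?_, rfl⟩)
      show T < (B₂ j).time x.1
      rw [htime]; linarith
    · exact Or.inr ⟨⟨y.1, hUmk y.1 (by linarith) hy2⟩, hy1, rfl⟩
  have hconvS : (⋃ j, Gl j '' {x | (boostedKerrBackground (Λ j) (c j) (M j) (a j)).time x = T + s j}) ∪ Φ '' {y : W₀ | y.1 0 = T ∧ P y.1} ⊆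
      (⋃ i, (Gl i ∘ TopologicalSpace.Opens.inclusion (hle i)) '' (B₂ i).timeSlab T) ∪ (Φ ∘ TopologicalSpace.Opens.inclusion hU₂le) '' (Minkowski.backgroundOn U₂).timeSlab T := by
    rintro q (hq | ⟨y, ⟨hy1, hy2⟩, rfl⟩)
    · obtain ⟨j, x, hx, rfl⟩ := mem_iUnion.mp hq |>.imp fun j h ↦ h
      have hx' : (boostedKerrBackground (Λ j) (c j) (M j) (a j)).time x.1 = T + s j := hx
      refine Or.inl (mem_iUnion.mpr ⟨j, ⟨x.1, hset j x.2⟩, ?_, rfl⟩)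
      show (B₂ j).time x.1 = T
      rw [htime]; linarith
    · exact Or.inr ⟨⟨y.1, hUmk y.1 (by rw [hy1]; linarith) hy2⟩, hy1, rfl⟩
  rintro q ⟨hqO, hqnot⟩
  exact LorentzianMetric.causalFuture_mono hconvS (hcov ⟨hqO, fun h ↦ hqnot (hconvL h)⟩)

/-- Every point of `O` is causally below the late charted region of the seamed decomposition
(`reach_charted` in the vocabulary of the new decomposition); with `exterior_congr` this gives
`O = exteriorOf 𝒟 d₂.charted`.  O'Neill 1983, Ch. 14, pp. 402–403. [folklore] -/
theorem reach₂ {N : ℕ} (Λ : Fin N → lorentzGroup) (c : Fin N → E4) (M a : Fin N → ℝ) (R₁ τ₁ τf T : ℝ) (s : Fin N → ℝ)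
    (hs : ∀ j, 0 ≤ s j)
    (hτ : τf ≤ τ₁)
    (hT : τ₁ + 3 ≤ T)
    (hdomeq : ∀ j (y y' : E4), (boostedKerrBackground (Λ j) (c j) (M j) (a j)).radius y' = (boostedKerrBackground (Λ j) (c j) (M j) (a j)).radius y → y ∈ (boostedKerrBackground (Λ j) (c j) (M j) (a j)).domain → y' ∈ (boostedKerrBackground (Λ j) (c j) (M j) (a j)).domain)
    (Rg : Fin N → ℝ → ℝ)
    (hRgm : ∀ j, Monotone (Rg j))
    (hRgc : ∀ j, Continuous (Rg j))
    (hRg4 : ∀ j t, R₁ + 4 ≤ Rg j t)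
    (b : Fin N → ℝ → ℝ)
    (hbRg : ∀ j t, Rg j t + 21 / 20 ≤ b j t ∧ b j t ≤ Rg j t + 29 / 20)
    (Ψ Ψ' Gl : ∀ j, (boostedKerrBackground (Λ j) (c j) (M j) (a j)).domain → 𝓢.carrier)
    (hA1a : ∀ j, ContMDiffOn 𝓘(ℝ, E4) (𝓡 4) ∞ (Ψ' j)
      {x | τ₁ < (boostedKerrBackground (Λ j) (c j) (M j) (a j)).time x ∧ (boostedKerrBackground (Λ j) (c j) (M j) (a j)).radius x < Rg j ((boostedKerrBackground (Λ j) (c j) (M j) (a j)).time x) + 2})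
    (hA2 : ∀ j (x : (boostedKerrBackground (Λ j) (c j) (M j) (a j)).domain), (boostedKerrBackground (Λ j) (c j) (M j) (a j)).radius x ≤ R₁ + 1 → Ψ' j x = Ψ j x)
    (hA8 : ∀ j (x : (boostedKerrBackground (Λ j) (c j) (M j) (a j)).domain), τ₁ ≤ (boostedKerrBackground (Λ j) (c j) (M j) (a j)).time x → R₁ ≤ (boostedKerrBackground (Λ j) (c j) (M j) (a j)).radius x →
      (boostedKerrBackground (Λ j) (c j) (M j) (a j)).radius x ≤ Rg j ((boostedKerrBackground (Λ j) (c j) (M j) (a j)).time x) + 2 →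
      𝓢.timeOrientation.IsFutureDirected
        (mfderiv 𝓘(ℝ, E4) (𝓡 4) (Ψ' j) x ((Λ j : E4 ≃L[ℝ] E4) (E4.basisVector 0))))
    (hHc2 : ∀ j (ϱ τ₂ : ℝ), R₁ ≤ ϱ → τf < τ₂ →
      Ψ j '' {x | τf < (boostedKerrBackground (Λ j) (c j) (M j) (a j)).time x ∧ (boostedKerrBackground (Λ j) (c j) (M j) (a j)).time x < τ₂ ∧ (boostedKerrBackground (Λ j) (c j) (M j) (a j)).radius x < ϱ} ⊆
        𝓢.metric.causalPast 𝓢.timeOrientation (Ψ j '' (boostedKerrBackground (Λ j) (c j) (M j) (a j)).truncTimeSlab ϱ τ₂))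
    (W₀ : TopologicalSpace.Opens E4) (Φ : W₀ → 𝓢.carrier) (P : E4 → Prop)
    (hA3 : ∀ j (y : E4) (hy : y ∈ (boostedKerrBackground (Λ j) (c j) (M j) (a j)).domain), τ₁ ≤ y 0 → P y →
      (boostedKerrBackground (Λ j) (c j) (M j) (a j)).radius y ≤ Rg j ((boostedKerrBackground (Λ j) (c j) (M j) (a j)).time y) + 2 → ∃ hw : y ∈ W₀, Ψ' j ⟨y, hy⟩ = Φ ⟨y, hw⟩)
    (hcollar : ∀ j (y : E4), y ∈ (boostedKerrBackground (Λ j) (c j) (M j) (a j)).domain → τ₁ + 1 + s j < (boostedKerrBackground (Λ j) (c j) (M j) (a j)).time y →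
      Rg j ((boostedKerrBackground (Λ j) (c j) (M j) (a j)).time y) + 17 / 20 < (boostedKerrBackground (Λ j) (c j) (M j) (a j)).radius y → (boostedKerrBackground (Λ j) (c j) (M j) (a j)).radius y < Rg j ((boostedKerrBackground (Λ j) (c j) (M j) (a j)).time y) + 2 →
      τ₁ ≤ y 0 ∧ τf < y 0 ∧ P y)
    (hGl2 : ∀ j (x : (boostedKerrBackground (Λ j) (c j) (M j) (a j)).domain), τ₁ + 2 + s j ≤ (boostedKerrBackground (Λ j) (c j) (M j) (a j)).time x → (boostedKerrBackground (Λ j) (c j) (M j) (a j)).radius x < b j ((boostedKerrBackground (Λ j) (c j) (M j) (a j)).time x) →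
      Gl j x = Ψ' j x)
    (hlag : ∀ j (y : E4), τ₁ ≤ (boostedKerrBackground (Λ j) (c j) (M j) (a j)).time y → (boostedKerrBackground (Λ j) (c j) (M j) (a j)).radius y ≤ Rg j ((boostedKerrBackground (Λ j) (c j) (M j) (a j)).time y) + 2 → (boostedKerrBackground (Λ j) (c j) (M j) (a j)).time y - s j ≤ y 0)
    (O : Set 𝓢.carrier)
    (hA13 : O \ (Φ '' {y : W₀ | T + 1 < y.1 0 ∧ P y.1} ∪
        ⋃ j, Ψ' j '' {x | τ₁ + 5 / 2 + s j < (boostedKerrBackground (Λ j) (c j) (M j) (a j)).time x ∧ (boostedKerrBackground (Λ j) (c j) (M j) (a j)).radius x < Rg j ((boostedKerrBackground (Λ j) (c j) (M j) (a j)).time x) + 2}) ⊆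
      𝓢.metric.causalPast 𝓢.timeOrientation (Φ '' {y : W₀ | y.1 0 = T + 1 ∧ P y.1} ∪
        ⋃ j, Ψ' j '' {x | (boostedKerrBackground (Λ j) (c j) (M j) (a j)).time x = τ₁ + 5 / 2 + s j ∧ (boostedKerrBackground (Λ j) (c j) (M j) (a j)).radius x < Rg j ((boostedKerrBackground (Λ j) (c j) (M j) (a j)).time x) + 2}))
    (B₂ : Fin N → ModelBackground) (hle : ∀ j, (B₂ j).domain ≤ (boostedKerrBackground (Λ j) (c j) (M j) (a j)).domain)
    (hset : ∀ j, ((boostedKerrBackground (Λ j) (c j) (M j) (a j)).domain : Set E4) ⊆ (B₂ j).domain)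
    (htime : ∀ j y, (B₂ j).time y = (boostedKerrBackground (Λ j) (c j) (M j) (a j)).time y - s j)
    (U₂ : TopologicalSpace.Opens E4) (hU₂le : U₂ ≤ W₀) (hUmk : ∀ y : E4, T - 1 < y 0 → P y → y ∈ U₂) :
    O ⊆ 𝓢.metric.causalPast 𝓢.timeOrientation
      ((Φ ∘ TopologicalSpace.Opens.inclusion hU₂le) '' (Minkowski.backgroundOn U₂).lateRegion T ∪ ⋃ i, (Gl i ∘ TopologicalSpace.Opens.inclusion (hle i)) '' (B₂ i).lateRegion T) := by
  have hreach := reach_charted N Λ c M a R₁ τ₁ τf T s hs hτ hT hdomeq Rg hRgm hRgc hRg4 b hbRg Ψ Ψ' Gl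
    hA1a hA2 hA8 hHc2 W₀ Φ P hA3 hcollar hGl2 hlag O hA13
  have hconvL : (⋃ j, Gl j '' {x | T + s j < (boostedKerrBackground (Λ j) (c j) (M j) (a j)).time x}) ∪ Φ '' {y : W₀ | T < y.1 0 ∧ P y.1} ⊆
      (Φ ∘ TopologicalSpace.Opens.inclusion hU₂le) '' (Minkowski.backgroundOn U₂).lateRegion T ∪ ⋃ i, (Gl i ∘ TopologicalSpace.Opens.inclusion (hle i)) '' (B₂ i).lateRegion T := by
    rintro q (hq | ⟨y, ⟨hy1, hy2⟩, rfl⟩)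
    · obtain ⟨j, x, hx, rfl⟩ := mem_iUnion.mp hq |>.imp fun j h ↦ h
      have hx' : T + s j < (boostedKerrBackground (Λ j) (c j) (M j) (a j)).time x.1 := hx
      refine Or.inr (mem_iUnion.mpr ⟨j, ⟨x.1, hset j x.2⟩, ?_, rfl⟩)
      show T < (B₂ j).time x.1
      rw [htime]; linarith
    · exact Or.inl ⟨⟨y.1, hUmk y.1 (by linarith) hy2⟩, hy1, rfl⟩
  exact fun q hq ↦ LorentzianMetric.causalFuture_mono hconvL (hreach hq)

/-- `Seamed` S11 of the seamed decomposition (`flat_closure` in the vocabulary of the new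
decomposition).  DHRT arXiv:2104.08222, §1. [folklore] -/
theorem seamed₂_eleven {N : ℕ} (Λ : Fin N → lorentzGroup) (c : Fin N → E4) (M a : Fin N → ℝ) (R₁ τ₁ τf T : ℝ) (s : Fin N → ℝ)
    (hs : ∀ j, 0 ≤ s j)
    (hτ : τf ≤ τ₁)
    (hT : τ₁ + 3 ≤ T)
    (hdom1 : ∀ j (y : E4), R₁ + 1 ≤ (boostedKerrBackground (Λ j) (c j) (M j) (a j)).radius y → y ∈ (boostedKerrBackground (Λ j) (c j) (M j) (a j)).domain)
    (Rg : Fin N → ℝ → ℝ)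
    (hRgc : ∀ j, Continuous (Rg j))
    (b : Fin N → ℝ → ℝ)
    (hbRg : ∀ j t, Rg j t + 21 / 20 ≤ b j t)
    (ρ' : Fin N → ℝ → ℝ) (hρ'c : ∀ j, Continuous (ρ' j)) (hρ'1 : ∀ j t, R₁ + 1 ≤ ρ' j t)
    (Ψ' Gl : ∀ j, (boostedKerrBackground (Λ j) (c j) (M j) (a j)).domain → 𝓢.carrier)
    (hA1a : ∀ j, ContMDiffOn 𝓘(ℝ, E4) (𝓡 4) ∞ (Ψ' j)
      {x | τ₁ < (boostedKerrBackground (Λ j) (c j) (M j) (a j)).time x ∧ (boostedKerrBackground (Λ j) (c j) (M j) (a j)).radius x < Rg j ((boostedKerrBackground (Λ j) (c j) (M j) (a j)).time x) + 2})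
    (W₀ : TopologicalSpace.Opens E4) (Φ : W₀ → 𝓢.carrier)
    (Q : E4 → Prop)
    (hΦ2 : IsOpenEmbedding (Set.restrict {w : W₀ | τf < w.1 0} Φ))
    (hf2 : ∀ τ'' : ℝ, τf < τ'' →
      closure (Φ '' {y : W₀ | τ'' ≤ y.1 0 ∧ Q y.1}) ⊆ Φ '' {y : W₀ | τ'' ≤ y.1 0})
    (hPQ : ∀ y : E4, τ₁ ≤ y 0 → (∀ j, ρ' j (y 0) < (boostedKerrBackground (Λ j) (c j) (M j) (a j)).radius y) → Q y)
    (hA3 : ∀ j (y : E4) (hy : y ∈ (boostedKerrBackground (Λ j) (c j) (M j) (a j)).domain), τ₁ ≤ y 0 → (∀ j, ρ' j (y 0) < (boostedKerrBackground (Λ j) (c j) (M j) (a j)).radius y) →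
      (boostedKerrBackground (Λ j) (c j) (M j) (a j)).radius y ≤ Rg j ((boostedKerrBackground (Λ j) (c j) (M j) (a j)).time y) + 2 → ∃ hw : y ∈ W₀, Ψ' j ⟨y, hy⟩ = Φ ⟨y, hw⟩)
    (hA5 : ∀ j (y : E4), τ₁ ≤ y 0 → (boostedKerrBackground (Λ j) (c j) (M j) (a j)).radius y ≤ ρ' j (y 0) → (boostedKerrBackground (Λ j) (c j) (M j) (a j)).radius y + 3 ≤ Rg j ((boostedKerrBackground (Λ j) (c j) (M j) (a j)).time y))
    (hY : ∀ j (y : E4), T < y 0 → (boostedKerrBackground (Λ j) (c j) (M j) (a j)).radius y ≤ Rg j ((boostedKerrBackground (Λ j) (c j) (M j) (a j)).time y) + 2 → τ₁ + 3 ≤ (boostedKerrBackground (Λ j) (c j) (M j) (a j)).time y - s j)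
    (hGl2 : ∀ j (x : (boostedKerrBackground (Λ j) (c j) (M j) (a j)).domain), τ₁ + 2 + s j ≤ (boostedKerrBackground (Λ j) (c j) (M j) (a j)).time x → (boostedKerrBackground (Λ j) (c j) (M j) (a j)).radius x < b j ((boostedKerrBackground (Λ j) (c j) (M j) (a j)).time x) →
      Gl j x = Ψ' j x)
    (B₂ : Fin N → ModelBackground) (hle : ∀ j, (B₂ j).domain ≤ (boostedKerrBackground (Λ j) (c j) (M j) (a j)).domain)
    (hset : ∀ j, ((boostedKerrBackground (Λ j) (c j) (M j) (a j)).domain : Set E4) ⊆ (B₂ j).domain)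
    (hrad : ∀ j y, (B₂ j).radius y = (boostedKerrBackground (Λ j) (c j) (M j) (a j)).radius y)
    (U₂ : TopologicalSpace.Opens E4) (hU₂le : U₂ ≤ W₀)
    (hUmk : ∀ y : E4, T - 1 < y 0 → (∀ j, ρ' j (y 0) < (boostedKerrBackground (Λ j) (c j) (M j) (a j)).radius y) → y ∈ U₂)
    (hUmem : ∀ y : E4, y ∈ U₂ → ∀ j, ρ' j (y 0) < (boostedKerrBackground (Λ j) (c j) (M j) (a j)).radius y) :
    ∀ τ' : ℝ, T < τ' →
      closure ((Φ ∘ TopologicalSpace.Opens.inclusion hU₂le) '' {y : U₂ | τ' ≤ y.1 0}) ⊆ (Φ ∘ TopologicalSpace.Opens.inclusion hU₂le) '' {y : U₂ | τ' ≤ y.1 0} ∪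
        ⋃ j, (Gl j ∘ TopologicalSpace.Opens.inclusion (hle j)) '' {x | τ' ≤ x.1 0 ∧ (B₂ j).radius x = ρ' j (x.1 0)} := by
  intro τ' hτ'
  have key := flat_closure N Λ c M a R₁ τ₁ τf T s hs hτ hT hdom1 Rg hRgc ρ' hρ'c hρ'1 Ψ' hA1a W₀ Φ Q hΦ2
    hf2 hPQ hA3 hA5 hY τ' hτ'
  have himg : (Φ ∘ TopologicalSpace.Opens.inclusion hU₂le) '' {y : U₂ | τ' ≤ y.1 0} =
      Φ '' {y : W₀ | τ' ≤ y.1 0 ∧ ∀ j, ρ' j (y.1 0) < (boostedKerrBackground (Λ j) (c j) (M j) (a j)).radius y.1} := by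
    apply Subset.antisymm
    · rintro _ ⟨y, hy, rfl⟩
      exact ⟨TopologicalSpace.Opens.inclusion hU₂le y, ⟨hy, hUmem y.1 y.2⟩, rfl⟩
    · rintro _ ⟨y, ⟨hy1, hy2⟩, rfl⟩
      exact ⟨⟨y.1, hUmk y.1 (by show T - 1 < y.1 0; linarith) hy2⟩, hy1, rfl⟩
  rw [himg]
  refine key.trans (union_subset_union le_rfl (iUnion_mono fun j ↦ ?_))
  rintro _ ⟨x, ⟨h1, h2, h3, h4⟩, rfl⟩
  refine ⟨⟨x.1, hset j x.2⟩, ⟨h1, by show (B₂ j).radius x.1 = _; rw [hrad]; exact h2⟩, ?_⟩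
  show Gl j ⟨x.1, _⟩ = Ψ' j x
  exact hGl2 j x (by linarith) (by linarith [hbRg j ((boostedKerrBackground (Λ j) (c j) (M j) (a j)).time x.1)])

end Summit.FinalStateConjecture.FinalStateConjecture.Theorems.NecksCertifyTwoCap.Seam

end
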